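import Summits.Ventures.HSemireg.UntwistComplexTrace
import Summits.Ventures.HSemireg.UntwistLeibnizTriangularShifted
import Summits.Ventures.HSemireg.UntwistComplexSigma
import HarnessLib

/-!
# Venture HSemireg — route R1.0, complex carriers: **`I`-semiregularity of a strictly perfect `E₀` iff of `E₀ ⊗ M`,
# UNCONDITIONALLY** — the Leibniz re-expansion `hσ` of th-4's `isISemiregularC_iff_isISemiregularC_twist` DISCHARGED
# (gs-g4 gen 22, brick C9 of `general-structure/COMPLEX-LEIBNIZ-PLAN-gs-g4.md`)

HONEST FRAMING. Homological algebra on the tree's REAL carriers (t-7's `HomComplex.sigmaC` / `IsISemiregularC`, th-4's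
cocycle twist `- ⊗ M`, the bricks C6–C8 of this lineage). Nothing about any variety; nothing here says HC, HC_CM or HC_AV is
proved. The hypotheses are exactly those of t-7's `sigmaC`: `X` an `S`-scheme, `E₀` a cochain complex of `𝒪_X`-modules
concentrated in `[a, b]` with finite locally free terms, `c` a unit `1`-cocycle (`M = lineBundle c`).

## The assembly

* `thetaPrime_eq` / `thetaPrime_eq_twistTheta` — the descended `- ⊗ M` on shifted Homs is th-4's CONSTRUCTED bijection
  `twistTheta` (`UntwistCocycleTwistSigma`), sandwich form via Mathlib's `mapDerivedCategoryFactors`;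
  `thetaPrime_complexAtiyahStep` — `θ′(At_j(E₀)) = δ((S_j E₀) ⊗ M)` (Mathlib `DerivedCategory.map_triangleOfSESδ`).
* `lamStep c j = [Q λ•_j]⁻¹ · δ((S_j E₀) ⊗ M) · [Q λ•_{j+1}]` and g21's Leibniz step in this spelling:
  `At_j(E₀ ⊗ M) = lamStep + ν_j` (`complexAtiyahStep_prolong`, via the transport device
  `complexAtiyahStep_twist_transport` — see its KERNEL NOTE: the two spellings `cocycleTwistComplex c E₀` /
  `(prolong c).obj E₀` of `E₀ ⊗ M` must never be identified by the kernel inside a shifted type).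
* The LEIBNIZ FAMILY `leibnizFamily c x i = θ′(x · ι• · At(E₀)^i) · [Q λ•_i]`: `leibnizFamily_leibniz` (one-sided Leibniz
  rule), `traceShiftedHom_leibnizFamily` (`Tr′_i` of it is `σ_i(x)`, brick C7d), `leibnizFamily_zero_comp` (its head times
  `At(E₀ ⊗ M)^q` is the argument of `σ′_q(θ′ x)`).
* **`sigmaC_twist_triangular`**: `σ′_q(θ x) = σ_q(x) + Σ_{i<q} u_{q,i}(σ_i x)` with EXPLICIT-EXISTENTIAL mixing maps
  (brick C8 `LeibnizChainShifted.exists_triangular`, centrality C6 `complexAtiyahStep_comp_nuClass`, linearity C7d).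
* **`isISemiregularC_iff_twist`** — `HomComplex.IsISemiregularC X E₀ a b hK I ↔
  HomComplex.IsISemiregularC X (cocycleTwistComplex c E₀) a b _ I` for EVERY lower set `I` (th-4's
  `isISemiregularC_iff_isISemiregularC_of_triangular` with `θ := twistTheta c E₀ 2`, `d_q := id`), and the FULL
  semiregularity case `isISemiregularC_univ_iff_twist`.

## References

* R.-O. Buchweitz, H. Flenner, Compositio Math. 137 (2003), Def. 4.1, §5 (`I`-semiregular). [BuchweitzFlenner2003]
* M. F. Atiyah, Trans. AMS 85 (1957), Prop. 10–12 (the Leibniz rule along `- ⊗ M`). [Atiyah1957]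
-/

noncomputable section

set_option backward.isDefEq.respectTransparency false

open CategoryTheory CategoryTheory.Limits AlgebraicGeometry DerivedCategory Finset

namespace Summit.Ventures.HSemireg

namespace HomComplex

open Literature.AlgebraicGeometry.Modules Literature.AlgebraicGeometry.Motives Literature.AlgebraicGeometry.HodgeTheory
  CocycleTwist LeibnizChainShifted

universe w u

variable {S : Type u} [CommRing S] (X : Over (Spec (CommRingCat.of S))) [HasDerivedCategory.{w} X.left.Modules]
  (K : CochainComplex X.left.Modules ℤ) (c : UnitCocycle X.left)

/-! ### `θ′` is th-4's `twistTheta`; `θ′(At_j) = δ((S_j E₀) ⊗ M)` -/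

/-- **Sandwich form of `θ′`**: `θ′(y) = FacM⁻¹ ≫ y.map Ψ ≫ FacM⟦n⟧'` with `Ψ = D(- ⊗ M)` (Mathlib's `mapDerivedCategory` of
the exact functor `- ⊗ M`) and `FacM` its factorisation through `Q` (uniqueness of localization lifts). [folklore] -/
theorem thetaPrime_eq {A B : CochainComplex X.left.Modules ℤ} {n : ℤ} (y : ShiftedHom (Q.obj A) (Q.obj B) n) :
    thetaPrime X c y =
      ((twistEquivalence X.left c).functor.mapDerivedCategoryFactors.inv.app A) ≫
        y.map (twistEquivalence X.left c).functor.mapDerivedCategory ≫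
          ((twistEquivalence X.left c).functor.mapDerivedCategoryFactors.hom.app B)⟦n⟧' := by
  haveI : NatTrans.CommShift (Iso.refl (prolong c)).hom ℤ := inferInstanceAs (NatTrans.CommShift (𝟙 (prolong c)) ℤ)
  haveI := natTrans_commShift_derivedLiftIsoMapDerivedCategory_hom (prolong c) (prolong_isInvertedBy X c)
    (twistEquivalence X.left c).functor (Iso.refl _)
  have hnat := ShiftedHom.map_naturality_2 y (derivedLiftIsoMapDerivedCategory (prolong c) (prolong_isInvertedBy X c)
    (twistEquivalence X.left c).functor (Iso.refl _))
  rw [ShiftedHom.mk₀_comp, ShiftedHom.comp_mk₀] at hnat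
  have hhom : (derivedLiftIsoMapDerivedCategory (prolong c) (prolong_isInvertedBy X c) (twistEquivalence X.left c).functor
      (Iso.refl _)).hom.app (Q.obj A) =
      (derivedLiftFac (prolong c) (prolong_isInvertedBy X c)).hom.app A ≫
        (twistEquivalence X.left c).functor.mapDerivedCategoryFactors.inv.app A := by
    rw [derivedLiftIsoMapDerivedCategory, Localization.liftNatIso_hom, Localization.liftNatTrans_app]
    change _ ≫ Q.map (𝟙 _) ≫ _ = _
    rw [CategoryTheory.Functor.map_id, Category.id_comp]
    rfl
  have hinv : (derivedLiftIsoMapDerivedCategory (prolong c) (prolong_isInvertedBy X c) (twistEquivalence X.left c).functor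
      (Iso.refl _)).inv.app (Q.obj B) =
      (twistEquivalence X.left c).functor.mapDerivedCategoryFactors.hom.app B ≫
        (derivedLiftFac (prolong c) (prolong_isInvertedBy X c)).inv.app B := by
    rw [derivedLiftIsoMapDerivedCategory, Localization.liftNatIso_inv, Localization.liftNatTrans_app]
    change _ ≫ Q.map (𝟙 _) ≫ _ = _
    rw [CategoryTheory.Functor.map_id, Category.id_comp]
    rfl
  rw [thetaPrime, shiftedHomMap_eq, ← hnat, hhom, hinv]
  simp only [Functor.map_comp, Category.assoc, Iso.inv_hom_id_app_assoc]
  simp only [← Functor.map_comp, Iso.inv_hom_id_app, Category.comp_id]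

/-- **`θ′ = twistTheta`** on `Hom_D(Q E₀, Q E₀⟦n⟧)`: the descended `- ⊗ M` on shifted Homs IS th-4's constructed additive
bijection. [folklore] -/
theorem thetaPrime_eq_twistTheta {n : ℤ} (x : ShiftedHom (Q.obj K) (Q.obj K) n) :
    thetaPrime X c x = twistTheta c K n x := by
  rw [thetaPrime_eq, twistTheta_apply]
  rfl

/-- **`θ′(At_j(E₀)) = δ((S_j E₀) ⊗ M)`** (Mathlib `DerivedCategory.map_triangleOfSESδ`). [cite: Atiyah1957, Prop. 10] -/
theorem thetaPrime_complexAtiyahStep (j : ℕ) :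
    thetaPrime X c (complexAtiyahStep X j K) = triangleOfSESδ (map_cocycleTwist_shortExact c j K) := by
  rw [thetaPrime_eq, complexAtiyahStep, ShiftedHom.map,
    DerivedCategory.map_triangleOfSESδ (twistEquivalence X.left c).functor (twistJetComplexShortComplex_shortExact (X := X) j K)]
  simp only [Category.assoc]
  erw [Iso.inv_hom_id_app_assoc, Iso.inv_hom_id_app_assoc, ← Functor.map_comp, Iso.inv_hom_id_app,
    CategoryTheory.Functor.map_id, Category.comp_id]

/-- `θ′` is multiplicative (C7a `shiftedHomMap_comp'`, respelled). [folklore] -/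
theorem thetaPrime_comp {A B C : CochainComplex X.left.Modules ℤ} {a' b' c' : ℤ} (x : ShiftedHom (Q.obj A) (Q.obj B) a')
    (y : ShiftedHom (Q.obj B) (Q.obj C) b') (h : b' + a' = c') :
    thetaPrime X c (x.comp y h) = (thetaPrime X c x).comp (thetaPrime X c y) h :=
  shiftedHomMap_comp' _ _ x y h

/-- `θ′` of a post-composition with `[Q g]`. [folklore] -/
theorem thetaPrime_comp_mk₀ {A B C : CochainComplex X.left.Modules ℤ} {n : ℤ} (y : ShiftedHom (Q.obj A) (Q.obj B) n)
    (g : B ⟶ C) :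
    thetaPrime X c (y.comp (ShiftedHom.mk₀ (0 : ℤ) rfl (Q.map g)) (zero_add n)) =
      (thetaPrime X c y).comp (ShiftedHom.mk₀ (0 : ℤ) rfl (Q.map ((prolong c).map g))) (zero_add n) :=
  shiftedHomMap_comp_mk₀ _ _ y g

/-! ### The Leibniz step in the `prolong` spelling -/

/-- `λ•_j` (retyped) is an isomorphism. [folklore] -/
instance isIso_lamP (j : ℕ) : IsIso (lamP X K c j) := by
  change IsIso (lamC c j K)
  infer_instance

variable (a b : ℤ) [K.IsStrictlyGE a] [K.IsStrictlyLE b] (hK : ∀ p, IsFiniteLocallyFree (K.X p))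

/-- **`Λ_j = [Q λ•_j]⁻¹ · δ((S_j E₀) ⊗ M) · [Q λ•_{j+1}]`** — the "untwisted part" of `At_j(E₀ ⊗ M)`. [folklore] -/
def lamStep (j : ℕ) :
    ShiftedHom (Q.obj (twistHodgeComplex X j ((prolong c).obj K))) (Q.obj (twistHodgeComplex X (j + 1) ((prolong c).obj K)))
      (1 : ℤ) :=
  (ShiftedHom.mk₀ (0 : ℤ) rfl (inv (Q.map (lamP X K c j)))).comp
    (ShiftedHom.comp (M := ℤ) (a := 1) (b := 0) (triangleOfSESδ (map_cocycleTwist_shortExact c j K))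
      (ShiftedHom.mk₀ (0 : ℤ) rfl (Q.map (lamP X K c (j + 1)))) (zero_add 1)) (add_zero 1)

/-- **Transport device** (KERNEL NOTE). g21's Leibniz step `complexAtiyahStep_cocycleTwist'` is stated for th-4's
spelling `cocycleTwistComplex c E₀` of `E₀ ⊗ M`, while the trace pipeline (C7) lives on `(prolong c).obj E₀`; the two
are definitionally equal after ONE `abbrev` unfolding each, but the kernel exhausts memory when asked to identify them
INSIDE a shifted type (`ShiftedHom (Q (E ⊗ Ωʲ)) (Q (E ⊗ Ωʲ⁺¹)) 1` with the two spellings of `E`; measured gen 22).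
So we generalize the step over the spelling `L` (bound by a propositional equation `e`, eliminated by `subst`, whose
motive abstracts `L` everywhere) and over the retyped `λ•`'s (tied to `lamC` by `HEq`): instantiating at
`L := (prolong c).obj E₀` then costs the kernel only complex-level identifications. [folklore] -/
theorem complexAtiyahStep_twist_transport (j : ℕ) (L : CochainComplex X.left.Modules ℤ) (e : cocycleTwistComplex c K = L)
    (lj : (prolong c).obj (twistHodgeComplex X j K) ⟶ twistHodgeComplex X j L)
    (lj1 : (prolong c).obj (twistHodgeComplex X (j + 1) K) ⟶ twistHodgeComplex X (j + 1) L) [IsIso (Q.map lj)]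
    (h1 : HEq lj (lamC c j K)) (h2 : HEq lj1 (lamC c (j + 1) K)) :
    complexAtiyahStep X j L =
      (ShiftedHom.mk₀ (0 : ℤ) rfl (inv (Q.map lj))).comp
          (ShiftedHom.comp (M := ℤ) (a := 1) (b := 0) (triangleOfSESδ (map_cocycleTwist_shortExact c j K))
            (ShiftedHom.mk₀ (0 : ℤ) rfl (Q.map lj1)) (zero_add 1)) (add_zero 1) +
        nuClass c j L := by
  subst e
  obtain rfl : lj = lamC c j K := eq_of_heq h1
  obtain rfl : lj1 = lamC c (j + 1) K := eq_of_heq h2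
  have h := complexAtiyahStep_cocycleTwist' c j K
  rw [nuStep_eq_nuClass] at h
  rw [ShiftedHom.mk₀_comp, ShiftedHom.comp_mk₀]
  exact h

/-- **g21's Leibniz step, `prolong` spelling**: `At_j(E₀ ⊗ M) = Λ_j + ν_j(E₀ ⊗ M)`. [cite: Atiyah1957, Prop. 10 and 12] -/
theorem complexAtiyahStep_prolong (j : ℕ) :
    complexAtiyahStep X j ((prolong c).obj K) = lamStep X K c j + nuClass c j ((prolong c).obj K) :=
  complexAtiyahStep_twist_transport X K c j ((prolong c).obj K) rfl (lamP X K c j) (lamP X K c (j + 1)) HEq.rfl HEq.rfl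

/-- `[Q λ•_j] · Λ_j = δ((S_j E₀) ⊗ M) · [Q λ•_{j+1}]`. [folklore] -/
theorem mk₀_lamP_comp_lamStep (j : ℕ) :
    (ShiftedHom.mk₀ (0 : ℤ) rfl (Q.map (lamP X K c j))).comp (lamStep X K c j) (add_zero 1) =
      ShiftedHom.comp (M := ℤ) (a := 1) (b := 0) (triangleOfSESδ (map_cocycleTwist_shortExact c j K))
        (ShiftedHom.mk₀ (0 : ℤ) rfl (Q.map (lamP X K c (j + 1)))) (zero_add 1) := by
  rw [lamStep, ← ShiftedHom.comp_assoc _ _ _ (add_zero 0) (add_zero 1) (by omega), ShiftedHom.mk₀_comp_mk₀,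
    IsIso.hom_inv_id, ShiftedHom.mk₀_id_comp]

/-! ### The Leibniz family `S′_i(x) = θ′(x · ι• · At(E₀)^i) · [Q λ•_i]` -/

/-- `x · ι• · At(E₀)^{i+1} = (x · ι• · At(E₀)^i) · At_i(E₀)`. [folklore] -/
theorem extMulAtiyahPower_succ (i : ℕ) (x : ShiftedHom (Q.obj K) (Q.obj K) (2 : ℤ)) :
    extMulAtiyahPower X K (i + 1) x =
      (extMulAtiyahPower X K i x).comp (complexAtiyahStep X i K)
        (show (1 : ℤ) + ((i : ℤ) + 2) = ((i + 1 : ℕ) : ℤ) + 2 by omega) := by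
  rw [extMulAtiyahPower, extMulAtiyahPower, complexAtiyahPower_succ,
    ← ShiftedHom.comp_assoc (x.comp (ShiftedHom.mk₀ (0 : ℤ) rfl (Q.map (toTwistHodgeZeroC X K))) (zero_add 2))
      (complexAtiyahPower X K i) (complexAtiyahStep X i K) (show (i : ℤ) + 2 = (i : ℤ) + 2 by rfl)
      (show (1 : ℤ) + (i : ℤ) = ((i + 1 : ℕ) : ℤ) by omega) (show (1 : ℤ) + (i : ℤ) + 2 = ((i + 1 : ℕ) : ℤ) + 2 by omega)]

/-- **The Leibniz family** `S′_i(x) := θ′(x · ι• · At(E₀)^i) · [Q λ•_i] : Q(E₀ ⊗ M) ⟶ Q((E₀ ⊗ M) ⊗ Ωⁱ)⟦i+2⟧`.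
[cite: BuchweitzFlenner2003, Def. 4.1] -/
def leibnizFamily (x : ShiftedHom (Q.obj K) (Q.obj K) (2 : ℤ)) (i : ℕ) :
    ShiftedHom (Q.obj ((prolong c).obj K)) (Q.obj (twistHodgeComplex X i ((prolong c).obj K))) ((i : ℤ) + 2) :=
  (thetaPrime X c (extMulAtiyahPower X K i x)).comp (ShiftedHom.mk₀ (0 : ℤ) rfl (Q.map (lamP X K c i))) (zero_add _)

/-- **The one-sided Leibniz rule** `S′_j · At_j(E₀ ⊗ M) = S′_{j+1} + S′_j · ν_j`. [cite: Atiyah1957, Prop. 10 and 12] -/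
theorem leibnizFamily_leibniz (x : ShiftedHom (Q.obj K) (Q.obj K) (2 : ℤ)) (j : ℕ) :
    (leibnizFamily X K c x j).comp (complexAtiyahStep X j ((prolong c).obj K))
        (show (1 : ℤ) + ((j : ℤ) + 2) = ((j + 1 : ℕ) : ℤ) + 2 by omega) =
      leibnizFamily X K c x (j + 1) +
        (leibnizFamily X K c x j).comp (nuClass c j ((prolong c).obj K))
          (show (1 : ℤ) + ((j : ℤ) + 2) = ((j + 1 : ℕ) : ℤ) + 2 by omega) := by
  rw [complexAtiyahStep_prolong, ShiftedHom.comp_add]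
  congr 1
  rw [leibnizFamily, leibnizFamily, extMulAtiyahPower_succ, thetaPrime_comp, thetaPrime_complexAtiyahStep]
  set T := thetaPrime X c (extMulAtiyahPower X K j x) with hT
  set L := ShiftedHom.mk₀ (0 : ℤ) rfl (Q.map (lamP X K c j)) with hL
  set L' := ShiftedHom.mk₀ (0 : ℤ) rfl (Q.map (lamP X K c (j + 1))) with hL'
  rw [ShiftedHom.comp_assoc T L (lamStep X K c j) (zero_add ((j : ℤ) + 2)) (add_zero 1)
      (show (1 : ℤ) + 0 + ((j : ℤ) + 2) = ((j + 1 : ℕ) : ℤ) + 2 by omega), hL, mk₀_lamP_comp_lamStep, ← hL',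
    ← ShiftedHom.comp_assoc T (triangleOfSESδ (map_cocycleTwist_shortExact c j K)) L'
      (show (1 : ℤ) + ((j : ℤ) + 2) = ((j + 1 : ℕ) : ℤ) + 2 by omega) (zero_add 1)
      (show (0 : ℤ) + 1 + ((j : ℤ) + 2) = ((j + 1 : ℕ) : ℤ) + 2 by omega)]

/-- **`Tr′_i(S′_i(x)) = σ_i(x)`** (brick C7d `traceShiftedHom_twist`). [cite: BuchweitzFlenner2003, Def. 4.1] -/
theorem traceShiftedHom_leibnizFamily (x : ShiftedHom (Q.obj K) (Q.obj K) (2 : ℤ)) (i : ℕ) :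
    traceShiftedHom X ((prolong c).obj K) a b (isFiniteLocallyFree_cocycleTwistComplex_X c hK) i (leibnizFamily X K c x i) =
      sigmaC X K a b hK i x := by
  rw [leibnizFamily, traceShiftedHom_twist, sigmaC_eq_traceShiftedHom]

/-! ### The head of the Leibniz family: `S′_0 · At(E₀ ⊗ M)^q = (θ′x · ι•) · At(E₀ ⊗ M)^q` -/

/-- `θ′` of a unit class is a unit class. [folklore] -/
theorem thetaPrime_mk₀_id (d : ℤ) (hd : d = 0) (A : CochainComplex X.left.Modules ℤ) :
    thetaPrime X c (ShiftedHom.mk₀ d hd (𝟙 (Q.obj A))) = ShiftedHom.mk₀ d hd (𝟙 (Q.obj ((prolong c).obj A))) := by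
  subst hd
  rw [thetaPrime, shiftedHomMap_eq, ShiftedHom.map_mk₀, CategoryTheory.Functor.map_id]
  simp only [ShiftedHom.mk₀, Category.id_comp]
  erw [← (shiftFunctorZero' (DerivedCategory X.left.Modules) (0 : ℤ) rfl).inv.naturality
    ((derivedLiftFac (prolong c) (prolong_isInvertedBy X c)).hom.app A), Iso.inv_hom_id_app_assoc]
  rfl

/-- `θ′` of the unit class typed in the cast degree `((0 : ℕ) : ℤ)`. [folklore] -/
theorem thetaPrime_mk₀_id_cast (A : CochainComplex X.left.Modules ℤ) :
    thetaPrime X c (ShiftedHom.mk₀ (0 : ℤ) rfl (𝟙 (Q.obj A)) : ShiftedHom (Q.obj A) (Q.obj A) ((0 : ℕ) : ℤ)) =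
      (ShiftedHom.mk₀ (0 : ℤ) rfl (𝟙 (Q.obj ((prolong c).obj A))) : ShiftedHom _ _ ((0 : ℕ) : ℤ)) :=
  thetaPrime_mk₀_id X c ((0 : ℕ) : ℤ) (by simp) A

/-- `mk₀ 𝟙 · g = g` when the unit class is typed in the cast degree `((0 : ℕ) : ℤ)`. [folklore] -/
theorem mk₀_id_comp_cast {C : Type*} [Category C] [HasShift C ℤ] {A B : C} {d : ℤ} (g : ShiftedHom A B d)
    (p : d + ((0 : ℕ) : ℤ) = d) :
    ShiftedHom.comp (a := ((0 : ℕ) : ℤ)) (ShiftedHom.mk₀ (0 : ℤ) rfl (𝟙 A)) g p = g :=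
  ShiftedHom.mk₀_id_comp ((0 : ℕ) : ℤ) (by simp) g

omit [HasDerivedCategory X.left.Modules] in
/-- **`(- ⊗ M)(ι•_{E₀}) ≫ λ•_0 = ι•_{E₀ ⊗ M}`** (gen 20's `toTwistHodgeZero_twist`, termwise). [cite: Hartshorne1977, II Ex. 5.1] -/
theorem prolong_map_toTwistHodgeZeroC_comp_lamP :
    (prolong c).map (toTwistHodgeZeroC X K) ≫ lamP X K c 0 = toTwistHodgeZeroC X ((prolong c).obj K) := by
  refine HomologicalComplex.hom_ext _ _ fun p => ?_
  rw [HomologicalComplex.comp_f, Functor.mapHomologicalComplex_map_f, lamP_f, toTwistHodgeZeroC_f, toTwistHodgeZeroC_f]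
  exact (toTwistHodgeZero_twist c (K.X p)).symm

/-- **The head of the Leibniz family**: `S′_0 · At(E₀ ⊗ M)^q = (θ′ x · [Q ι•]) · At(E₀ ⊗ M)^q` — the argument of
`σ_q(θ′ x)` for `E₀ ⊗ M`. [cite: BuchweitzFlenner2003, Def. 4.1] -/
theorem leibnizFamily_zero_comp (x : ShiftedHom (Q.obj K) (Q.obj K) (2 : ℤ)) (q : ℕ) :
    (leibnizFamily X K c x 0).comp (complexAtiyahPower X ((prolong c).obj K) q)
        (show (q : ℤ) + (((0 : ℕ) : ℤ) + 2) = (q : ℤ) + 2 by omega) =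
      extMulAtiyahPower X ((prolong c).obj K) q (thetaPrime X c x) := by
  rw [leibnizFamily, extMulAtiyahPower, extMulAtiyahPower, complexAtiyahPower_zero, thetaPrime_comp, thetaPrime_comp_mk₀]
  rw [thetaPrime_mk₀_id_cast, ← prolong_map_toTwistHodgeZeroC_comp_lamP, mk₀_map_comp]
  set W := (thetaPrime X c x).comp (ShiftedHom.mk₀ (0 : ℤ) rfl (Q.map ((prolong c).map (toTwistHodgeZeroC X K))))
    (zero_add 2) with hW
  set L := ShiftedHom.mk₀ (0 : ℤ) rfl (Q.map (lamP X K c 0)) with hL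
  set B := complexAtiyahPower X ((prolong c).obj K) q with hB
  rw [ShiftedHom.comp_assoc (W.comp (ShiftedHom.mk₀ (0 : ℤ) rfl (𝟙 _) : ShiftedHom _ _ ((0 : ℕ) : ℤ)) _) L B
      (zero_add _) (add_zero _) (show (q : ℤ) + 0 + (((0 : ℕ) : ℤ) + 2) = (q : ℤ) + 2 by omega),
    ShiftedHom.comp_assoc W (ShiftedHom.mk₀ (0 : ℤ) rfl (𝟙 _) : ShiftedHom _ _ ((0 : ℕ) : ℤ)) (L.comp B (add_zero _))
      (show ((0 : ℕ) : ℤ) + 2 = ((0 : ℕ) : ℤ) + 2 by rfl) (show (q : ℤ) + ((0 : ℕ) : ℤ) = q by omega)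
      (show (q : ℤ) + ((0 : ℕ) : ℤ) + 2 = (q : ℤ) + 2 by omega),
    mk₀_id_comp_cast, hW,
    ShiftedHom.comp_assoc (thetaPrime X c x) _ (L.comp B (add_zero _)) (zero_add 2) (show (q : ℤ) + 0 = q by omega)
      (show (q : ℤ) + 0 + 2 = (q : ℤ) + 2 by omega),
    ShiftedHom.comp_assoc (thetaPrime X c x) _ B (zero_add 2) (show (q : ℤ) + 0 = q by omega)
      (show (q : ℤ) + 0 + 2 = (q : ℤ) + 2 by omega),
    ShiftedHom.comp_assoc _ L B (add_zero 0) (add_zero _) (show (q : ℤ) + 0 + 0 = q by omega)]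

/-! ### The triangular re-expansion and the END THEOREM -/

/-- The re-expansion with `- ⊗ M` spelled `prolong`. [cite: BuchweitzFlenner2003, Def. 4.1 and §5; Atiyah1957, Prop. 10 and 12] -/
theorem sigmaC_prolong_triangular (q : ℕ) :
    ∃ u : ∀ j : ℕ,
      ShiftedHom (Q.obj ((HomologicalComplex.single X.left.Modules (ComplexShape.up ℤ) 0).obj (unitModule X.left)))
          (Q.obj ((HomologicalComplex.single X.left.Modules (ComplexShape.up ℤ) 0).obj (hodgeSheaf X j))) ((j + 2 : ℕ) : ℤ) →+
        ShiftedHom (Q.obj ((HomologicalComplex.single X.left.Modules (ComplexShape.up ℤ) 0).obj (unitModule X.left)))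
          (Q.obj ((HomologicalComplex.single X.left.Modules (ComplexShape.up ℤ) 0).obj (hodgeSheaf X q))) ((q + 2 : ℕ) : ℤ),
      ∀ x : ShiftedHom (Q.obj K) (Q.obj K) (2 : ℤ),
        sigmaC X ((prolong c).obj K) a b (isFiniteLocallyFree_cocycleTwistComplex_X c hK) q (thetaPrime X c x) =
          sigmaC X K a b hK q x + ∑ j ∈ range q, u j (sigmaC X K a b hK j x) := by
  obtain ⟨V, hV⟩ := exists_triangular (fun j => complexAtiyahStep X j ((prolong c).obj K))
    (fun j => (nuClass c j ((prolong c).obj K) : ShiftedHom _ _ (1 : ℤ)))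
    (fun i => traceShiftedHom X ((prolong c).obj K) a b (isFiniteLocallyFree_cocycleTwistComplex_X c hK) i)
    (fun i => compDlogScalarClass X c i) q
    (fun m _ => (complexAtiyahStep_comp_nuClass c m ((prolong c).obj K) rfl).symm)
    (fun i _ y => traceShiftedHom_comp_nuClass X ((prolong c).obj K) a b (isFiniteLocallyFree_cocycleTwistComplex_X c hK) c i y)
    (complexAtiyahPower X ((prolong c).obj K)) (complexAtiyahPower_zero X _) (fun q => complexAtiyahPower_succ X _ q) q
    le_rfl
  refine ⟨V, fun x => ?_⟩
  have h := hV (leibnizFamily X K c x) (fun j _ => leibnizFamily_leibniz X K c x j)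
  rw [leibnizFamily_zero_comp,
    ← sigmaC_eq_traceShiftedHom X ((prolong c).obj K) a b (isFiniteLocallyFree_cocycleTwistComplex_X c hK) q
      (thetaPrime X c x), traceShiftedHom_leibnizFamily X K c a b hK x q] at h
  refine h.trans ?_
  congr 1
  exact Finset.sum_congr rfl fun i _ => congrArg (V i) (traceShiftedHom_leibnizFamily X K c a b hK x i)

/-- `σ_q` of the twisted complex in the two spellings (definitional). [folklore] -/
theorem sigmaC_prolong_eq (q : ℕ) (z) :
    sigmaC X ((prolong c).obj K) a b (isFiniteLocallyFree_cocycleTwistComplex_X c hK) q z =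
      sigmaC X (cocycleTwistComplex c K) a b (isFiniteLocallyFree_cocycleTwistComplex_X c hK) q z :=
  rfl

/-- **The Leibniz re-expansion `hσ` of th-4's `isISemiregularC_iff_isISemiregularC_twist`, PROVED**:
`σ′_q(θ x) = σ_q(x) + Σ_{j<q} u_{q,j}(σ_j x)` for the REAL `σ_q` of `E₀` and of `E₀ ⊗ M`, `θ = twistTheta c E₀ 2`
(th-4's constructed bijection), with (existential) additive mixing maps `u_{q,j}`.
[cite: BuchweitzFlenner2003, Def. 4.1 and §5; Atiyah1957, Prop. 10 and 12] -/
theorem sigmaC_twist_triangular (q : ℕ) :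
    ∃ u : ∀ j : ℕ,
      ShiftedHom (Q.obj ((HomologicalComplex.single X.left.Modules (ComplexShape.up ℤ) 0).obj (unitModule X.left)))
          (Q.obj ((HomologicalComplex.single X.left.Modules (ComplexShape.up ℤ) 0).obj (hodgeSheaf X j))) ((j + 2 : ℕ) : ℤ) →+
        ShiftedHom (Q.obj ((HomologicalComplex.single X.left.Modules (ComplexShape.up ℤ) 0).obj (unitModule X.left)))
          (Q.obj ((HomologicalComplex.single X.left.Modules (ComplexShape.up ℤ) 0).obj (hodgeSheaf X q))) ((q + 2 : ℕ) : ℤ),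
      ∀ x : ShiftedHom (Q.obj K) (Q.obj K) (2 : ℤ),
        sigmaC X (cocycleTwistComplex c K) a b (isFiniteLocallyFree_cocycleTwistComplex_X c hK) q (twistTheta c K 2 x) =
          sigmaC X K a b hK q x + ∑ j ∈ range q, u j (sigmaC X K a b hK j x) := by
  obtain ⟨u, hu⟩ := sigmaC_prolong_triangular X K c a b hK q
  refine ⟨u, fun x => ?_⟩
  rw [← thetaPrime_eq_twistTheta, ← sigmaC_prolong_eq X K c a b hK]
  exact hu x

/-- **THE END THEOREM. `I`-semiregularity of a strictly perfect `E₀` iff of `E₀ ⊗ M`, UNCONDITIONALLY**: for `X` an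
`S`-scheme, `E₀` a cochain complex of `𝒪_X`-modules in `[a, b]` with finite locally free terms, `c` a unit `1`-cocycle
(`M = lineBundle c`) and EVERY lower set `I` of form degrees,
`HomComplex.IsISemiregularC X E₀ a b hK I ↔ HomComplex.IsISemiregularC X (E₀ ⊗ M) a b _ I` — th-4's
`isISemiregularC_iff_isISemiregularC_of_triangular` at `θ := twistTheta c E₀ 2`, `d_q := id`, its hypothesis `hσ` now
`sigmaC_twist_triangular`. (The complex-carrier twin of gen 20's `CocycleTwist.isISemiregular_iff_twist_of_locallyFree`;
no coframe / smoothness hypothesis is needed here.) [cite: BuchweitzFlenner2003, Def. 4.1 and §5; Atiyah1957, Prop. 10 and 12] -/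
theorem isISemiregularC_iff_twist {I : Set ℕ} (hI : IsLowerSet I) :
    IsISemiregularC X K a b hK I ↔
      IsISemiregularC X (cocycleTwistComplex c K) a b (isFiniteLocallyFree_cocycleTwistComplex_X c hK) I := by
  choose u hu using sigmaC_twist_triangular X K c a b hK
  exact isISemiregularC_iff_isISemiregularC_of_triangular K (cocycleTwistComplex c K) a b a b hK
    (isFiniteLocallyFree_cocycleTwistComplex_X c hK) (twistTheta c K 2) (fun _ => AddMonoidHom.id _) (fun q j => u q j) hI
    (fun _ _ => Function.injective_id) fun q _ x => by rw [AddMonoidHom.id_apply]; exact hu q x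

/-- **FULL semiregularity** (`I = univ`): `E₀` is semiregular iff `E₀ ⊗ M` is. [cite: BuchweitzFlenner2003, Def. 4.1 and §5] -/
theorem isISemiregularC_univ_iff_twist :
    IsISemiregularC X K a b hK Set.univ ↔
      IsISemiregularC X (cocycleTwistComplex c K) a b (isFiniteLocallyFree_cocycleTwistComplex_X c hK) Set.univ :=
  isISemiregularC_iff_twist X K c a b hK isLowerSet_univ

end HomComplex

end Summit.Ventures.HSemireg

end
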